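import Mathlib
import HarnessLib
import Summits.Ventures.LatticeQCDFlow.Exactness.SUNLeapfrogHMCEngine

/-!
# The engine's `SU(N)` coordinates read as a pairing: `−tr(PP')` on `sunCoordι` is the symmetric bilinear form `sunCoordPairing`, with `B(c,c) = sunCoordQuad c` (so `sunKinetic N p = Σ_l B(p_l,p_l)`), `|B(c,c')| ≤ (N + 4·#pairs)‖c‖‖c'‖`, and `‖sunCoordι c‖_{∞-op} ≤ 2N‖c‖` — the dictionary that puts the engine's own `SU(N)` kernel under the general-coordinates acceptance laws

HONEST FRAMING: exact (Metropolis-corrected) sampling algorithms for lattice gauge theory;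
figures of merit are autocorrelation/cost numbers at stated couplings and volumes; no
continuum-physics claim.

Venture `LatticeQCDFlow` (cell pub-lqcd), topic `Exactness`; FANOUT row 14 (`eng-flowhmc`, family B; the `SU(N)`
rung of rows 21–26 runs row 9's engine coordinates `sunCoordι N` / kinetic term `sunKinetic N = −Σ tr P²` on
`SUNCoords N`).  NEW WORK of the cell over row 9's `SUNKickCoordinates` (`SUNCoords N = zeroSum N × (ℝ^{pairs} × ℝ^{pairs})`,
`sunCoordι`, `sunCoordMatrix`) and `SUNLeapfrogHMCEngine` (`sunCoordQuad`, `sunKinetic`); nothing is cited as a fact; no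
number.  WHY: the general-coordinates laws (`SUNExpDriftWork`, `SUNLeapfrogEnergyError`, `SUNOmf2EnergyError`, …) are
stated for ANY coordinates `ι` with a norm bound `‖ι x‖ ≤ C_ι‖x‖`, ANY symmetric pairing `B` with `|B(x,y)| ≤ β‖x‖‖y‖`,
and the kinetic term `κΣ_l B(p_l,p_l)`.  The coordinate space `SUNCoords N` carries the product sup norm, in which
`−tr P²` is NOT `‖·‖²`; this file supplies the `B`, `β`, `C_ι` that make those laws statements about the engine's kernel
`sunLeapfrogHMCN (sunCoordι N) (sunCoordι_skew N) ε addHaar (sunKinetic N) …` verbatim (`κ = 1`).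

* **`sunCoordPairing N : SUNCoords N →ₗ[ℝ] SUNCoords N →ₗ[ℝ] ℝ`** — `B(c,c') = Σ_i d_i d'_i + 2Σ_{i<j}(R_ij R'_ij + I_ij I'_ij)`
  (`= −tr(ι c · ι c')`, not re-derived as a trace here); `sunCoordPairing_apply`;
* `sunCoordPairing_comm` (symmetric); **`sunCoordPairing_self`** (`B(c,c) = sunCoordQuad N c`);
  **`sunKinetic_eq_sum_pairing`** (`sunKinetic N p = Σ_l B(p_l,p_l) = 1·Σ_l B(p_l,p_l)`);
* **`abs_sunCoordPairing_le`** — `|B(c,c')| ≤ (N + 4·#pairs)·‖c‖·‖c'‖` (`β`; the same constant as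
  `sunCoordQuad_le`);
* `norm_sunCoordMatrix_entry_le` (every entry of `ι c` has modulus `≤ 2‖c‖`), **`norm_sunCoordι_le`** —
  `‖sunCoordι N c‖_{∞-op} ≤ 2N·‖c‖` (`C_ι = 2N`; not optimised).

NOT CLAIMED: that the engine's autodiff kick is the `B`-gradient (row 9's `kickCoeffMap` dictionary — the consistency
hypothesis `hg` of the energy-error laws is what a user checks); positivity constants of `B` beyond `sunCoordQuad`'s;
any number.
-/

noncomputable section

namespace Summit.Ventures.LatticeQCDFlow.Exactness

open Set Function
open scoped Matrix Matrix.Norms.Operator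

variable (N : ℕ)

/-! ## §1 The pairing -/

/-- **The engine's kinetic pairing on `SUNCoords N`**: `B(c,c') = Σ_i d_i d'_i + 2Σ_{i<j}(R_ij R'_ij + I_ij I'_ij)`
(the polarisation of `sunCoordQuad = −tr P²`). -/
def sunCoordPairing : SUNCoords N →ₗ[ℝ] SUNCoords N →ₗ[ℝ] ℝ :=
  LinearMap.mk₂ ℝ
    (fun c c' => ∑ i, (c.1 : Fin N → ℝ) i * (c'.1 : Fin N → ℝ) i + 2 * ∑ p, (c.2.1 p * c'.2.1 p + c.2.2 p * c'.2.2 p))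
    (fun c₁ c₂ c' => by
      simp only [Prod.fst_add, Prod.snd_add, Submodule.coe_add, Pi.add_apply]
      rw [show (2 : ℝ) * ∑ p, ((c₁.2.1 p + c₂.2.1 p) * c'.2.1 p + (c₁.2.2 p + c₂.2.2 p) * c'.2.2 p) =
          2 * ∑ p, (c₁.2.1 p * c'.2.1 p + c₁.2.2 p * c'.2.2 p) + 2 * ∑ p, (c₂.2.1 p * c'.2.1 p + c₂.2.2 p * c'.2.2 p) by
            rw [← mul_add, ← Finset.sum_add_distrib]; congr 1; exact Finset.sum_congr rfl fun p _ => by ring,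
        show ∑ i, ((c₁.1 : Fin N → ℝ) i + (c₂.1 : Fin N → ℝ) i) * (c'.1 : Fin N → ℝ) i =
          ∑ i, (c₁.1 : Fin N → ℝ) i * (c'.1 : Fin N → ℝ) i + ∑ i, (c₂.1 : Fin N → ℝ) i * (c'.1 : Fin N → ℝ) i by
            rw [← Finset.sum_add_distrib]; exact Finset.sum_congr rfl fun i _ => by ring]
      ring)
    (fun a c c' => by
      simp only [Prod.smul_fst, Prod.smul_snd, Submodule.coe_smul, Pi.smul_apply, smul_eq_mul]
      simp only [mul_add, Finset.mul_sum]
      congr 1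
      · exact Finset.sum_congr rfl fun i _ => by ring
      · exact Finset.sum_congr rfl fun p _ => by ring)
    (fun c c₁ c₂ => by
      simp only [Prod.fst_add, Prod.snd_add, Submodule.coe_add, Pi.add_apply]
      rw [show (2 : ℝ) * ∑ p, (c.2.1 p * (c₁.2.1 p + c₂.2.1 p) + c.2.2 p * (c₁.2.2 p + c₂.2.2 p)) =
          2 * ∑ p, (c.2.1 p * c₁.2.1 p + c.2.2 p * c₁.2.2 p) + 2 * ∑ p, (c.2.1 p * c₂.2.1 p + c.2.2 p * c₂.2.2 p) by
            rw [← mul_add, ← Finset.sum_add_distrib]; congr 1; exact Finset.sum_congr rfl fun p _ => by ring,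
        show ∑ i, (c.1 : Fin N → ℝ) i * ((c₁.1 : Fin N → ℝ) i + (c₂.1 : Fin N → ℝ) i) =
          ∑ i, (c.1 : Fin N → ℝ) i * (c₁.1 : Fin N → ℝ) i + ∑ i, (c.1 : Fin N → ℝ) i * (c₂.1 : Fin N → ℝ) i by
            rw [← Finset.sum_add_distrib]; exact Finset.sum_congr rfl fun i _ => by ring]
      ring)
    (fun a c c' => by
      simp only [Prod.smul_fst, Prod.smul_snd, Submodule.coe_smul, Pi.smul_apply, smul_eq_mul]
      simp only [mul_add, Finset.mul_sum]
      congr 1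
      · exact Finset.sum_congr rfl fun i _ => by ring
      · exact Finset.sum_congr rfl fun p _ => by ring)

/-- Evaluation of the pairing. -/
@[simp] theorem sunCoordPairing_apply (c c' : SUNCoords N) :
    sunCoordPairing N c c' = ∑ i, (c.1 : Fin N → ℝ) i * (c'.1 : Fin N → ℝ) i + 2 * ∑ p, (c.2.1 p * c'.2.1 p + c.2.2 p * c'.2.2 p) :=
  rfl

/-- **The pairing is symmetric.** -/
theorem sunCoordPairing_comm (c c' : SUNCoords N) : sunCoordPairing N c c' = sunCoordPairing N c' c := by
  rw [sunCoordPairing_apply, sunCoordPairing_apply]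
  congr 1
  · exact Finset.sum_congr rfl fun i _ => mul_comm _ _
  · congr 1
    exact Finset.sum_congr rfl fun p _ => by ring

/-- **On the diagonal the pairing is the engine's kinetic quadratic form**: `B(c,c) = sunCoordQuad N c` (`= −tr P²`). -/
theorem sunCoordPairing_self (c : SUNCoords N) : sunCoordPairing N c c = sunCoordQuad N c := by
  rw [sunCoordPairing_apply, sunCoordQuad]
  congr 1
  · exact Finset.sum_congr rfl fun i _ => by ring
  · congr 1
    exact Finset.sum_congr rfl fun p _ => by ring

variable {L : Type*} [Fintype L]

/-- **The engine's kinetic term is the pairing summed over the links**: `sunKinetic N p = Σ_l B(p_l, p_l)`. -/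
theorem sunKinetic_eq_sum_pairing (p : L → SUNCoords N) : sunKinetic N p = ∑ l, sunCoordPairing N (p l) (p l) := by
  unfold sunKinetic
  exact Finset.sum_congr rfl fun l _ => (sunCoordPairing_self N (p l)).symm

/-- The same with the unit kinetic coefficient of the general-coordinates laws displayed: `sunKinetic N p = 1·Σ_l B(p_l, p_l)`. -/
theorem sunKinetic_eq_one_mul_sum_pairing (p : L → SUNCoords N) :
    sunKinetic N p = 1 * ∑ l, sunCoordPairing N (p l) (p l) := by
  rw [one_mul, sunKinetic_eq_sum_pairing]

/-! ## §2 The constants `β` and `C_ι` of the engine's coordinates -/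

omit [Fintype L] in
/-- Every coordinate is bounded by the sup norm: `|d_i|, |R_p|, |I_p| ≤ ‖c‖`. -/
theorem sunCoords_components_le (c : SUNCoords N) :
    (∀ i, |(c.1 : Fin N → ℝ) i| ≤ ‖c‖) ∧ (∀ p, |c.2.1 p| ≤ ‖c‖) ∧ (∀ p, |c.2.2 p| ≤ ‖c‖) := by
  refine ⟨fun i => ?_, fun p => ?_, fun p => ?_⟩
  · calc |(c.1 : Fin N → ℝ) i| = ‖(c.1 : Fin N → ℝ) i‖ := (Real.norm_eq_abs _).symm
      _ ≤ ‖(c.1 : Fin N → ℝ)‖ := norm_le_pi_norm _ i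
      _ = ‖c.1‖ := (Submodule.coe_norm _).symm
      _ ≤ ‖c‖ := norm_fst_le c
  · calc |c.2.1 p| = ‖c.2.1 p‖ := (Real.norm_eq_abs _).symm
      _ ≤ ‖c.2.1‖ := norm_le_pi_norm _ p
      _ ≤ ‖c.2‖ := norm_fst_le c.2
      _ ≤ ‖c‖ := norm_snd_le c
  · calc |c.2.2 p| = ‖c.2.2 p‖ := (Real.norm_eq_abs _).symm
      _ ≤ ‖c.2.2‖ := norm_le_pi_norm _ p
      _ ≤ ‖c.2‖ := norm_snd_le c.2
      _ ≤ ‖c‖ := norm_snd_le c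

omit [Fintype L] in
/-- **`|B(c,c')| ≤ (N + 4·#pairs)·‖c‖·‖c'‖`** (the `β` of the general-coordinates laws for the engine's coordinates). -/
theorem abs_sunCoordPairing_le (c c' : SUNCoords N) :
    |sunCoordPairing N c c'| ≤ (N + 4 * Fintype.card (UpperPair N)) * ‖c‖ * ‖c'‖ := by
  obtain ⟨hd, hR, hI⟩ := sunCoords_components_le N c
  obtain ⟨hd', hR', hI'⟩ := sunCoords_components_le N c'
  have h0 : 0 ≤ ‖c‖ := norm_nonneg _
  have h0' : 0 ≤ ‖c'‖ := norm_nonneg _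
  rw [sunCoordPairing_apply]
  have h1 : |∑ i, (c.1 : Fin N → ℝ) i * (c'.1 : Fin N → ℝ) i| ≤ N * (‖c‖ * ‖c'‖) := by
    refine (Finset.abs_sum_le_sum_abs _ _).trans ?_
    calc ∑ i, |(c.1 : Fin N → ℝ) i * (c'.1 : Fin N → ℝ) i| ≤ ∑ _i : Fin N, ‖c‖ * ‖c'‖ :=
          Finset.sum_le_sum fun i _ => by rw [abs_mul]; exact mul_le_mul (hd i) (hd' i) (abs_nonneg _) h0
      _ = N * (‖c‖ * ‖c'‖) := by rw [Finset.sum_const, Finset.card_univ, Fintype.card_fin, nsmul_eq_mul]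
  have h2 : |2 * ∑ p, (c.2.1 p * c'.2.1 p + c.2.2 p * c'.2.2 p)| ≤ 4 * Fintype.card (UpperPair N) * (‖c‖ * ‖c'‖) := by
    rw [abs_mul, abs_two]
    have h : |∑ p, (c.2.1 p * c'.2.1 p + c.2.2 p * c'.2.2 p)| ≤ Fintype.card (UpperPair N) * (2 * (‖c‖ * ‖c'‖)) := by
      refine (Finset.abs_sum_le_sum_abs _ _).trans ?_
      calc ∑ p, |c.2.1 p * c'.2.1 p + c.2.2 p * c'.2.2 p| ≤ ∑ _p : UpperPair N, 2 * (‖c‖ * ‖c'‖) :=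
            Finset.sum_le_sum fun p _ => by
              refine (abs_add_le _ _).trans ?_
              rw [abs_mul, abs_mul]
              nlinarith [mul_le_mul (hR p) (hR' p) (abs_nonneg _) h0, mul_le_mul (hI p) (hI' p) (abs_nonneg _) h0]
        _ = Fintype.card (UpperPair N) * (2 * (‖c‖ * ‖c'‖)) := by rw [Finset.sum_const, Finset.card_univ, nsmul_eq_mul]
    nlinarith [h]
  calc |∑ i, (c.1 : Fin N → ℝ) i * (c'.1 : Fin N → ℝ) i + 2 * ∑ p, (c.2.1 p * c'.2.1 p + c.2.2 p * c'.2.2 p)|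
      ≤ |∑ i, (c.1 : Fin N → ℝ) i * (c'.1 : Fin N → ℝ) i| + |2 * ∑ p, (c.2.1 p * c'.2.1 p + c.2.2 p * c'.2.2 p)| := abs_add_le _ _
    _ ≤ N * (‖c‖ * ‖c'‖) + 4 * Fintype.card (UpperPair N) * (‖c‖ * ‖c'‖) := add_le_add h1 h2
    _ = (N + 4 * Fintype.card (UpperPair N)) * ‖c‖ * ‖c'‖ := by ring

omit [Fintype L] in
/-- Every entry of the coordinate matrix has modulus at most `2‖c‖`. -/
theorem norm_sunCoordMatrix_entry_le (c : SUNCoords N) (i j : Fin N) : ‖sunCoordι N c i j‖ ≤ 2 * ‖c‖ := by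
  obtain ⟨hd, hR, hI⟩ := sunCoords_components_le N c
  have h0 : 0 ≤ ‖c‖ := norm_nonneg _
  rw [sunCoordι_apply]
  rcases lt_trichotomy i j with h | rfl | h
  · rw [sunCoordMatrix_apply_of_lt N _ _ _ h]
    refine (norm_add_le _ _).trans ?_
    rw [norm_mul, Complex.norm_I, mul_one, Complex.norm_real, Complex.norm_real, Real.norm_eq_abs, Real.norm_eq_abs]
    linarith [hR ⟨(i, j), h⟩, hI ⟨(i, j), h⟩]
  · rw [sunCoordMatrix_apply_self, norm_mul, Complex.norm_I, mul_one, Complex.norm_real, Real.norm_eq_abs]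
    linarith [hd i]
  · rw [sunCoordMatrix_apply_of_gt N _ _ _ h]
    refine (norm_add_le _ _).trans ?_
    rw [norm_neg, norm_mul, Complex.norm_I, mul_one, Complex.norm_real, Complex.norm_real, Real.norm_eq_abs, Real.norm_eq_abs]
    linarith [hR ⟨(j, i), h⟩, hI ⟨(j, i), h⟩]

omit [Fintype L] in
/-- **`‖sunCoordι N c‖_{∞-op} ≤ 2N·‖c‖`** (the `C_ι` of the general-coordinates laws for the engine's coordinates; each
row has `N` entries of modulus `≤ 2‖c‖`). -/
theorem norm_sunCoordι_le (c : SUNCoords N) : ‖sunCoordι N c‖ ≤ 2 * N * ‖c‖ := by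
  have hrow : ∀ i : Fin N, ∑ j, ‖sunCoordι N c i j‖ ≤ 2 * N * ‖c‖ := by
    intro i
    calc ∑ j, ‖sunCoordι N c i j‖ ≤ ∑ _j : Fin N, 2 * ‖c‖ := Finset.sum_le_sum fun j _ => norm_sunCoordMatrix_entry_le N c i j
      _ = 2 * N * ‖c‖ := by rw [Finset.sum_const, Finset.card_univ, Fintype.card_fin, nsmul_eq_mul]; ring
  rw [Matrix.linfty_opNorm_def]
  have h : ((Finset.univ : Finset (Fin N)).sup fun i : Fin N => ∑ j : Fin N, ‖sunCoordι N c i j‖₊) ≤ ⟨2 * N * ‖c‖, by positivity⟩ := by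
    refine Finset.sup_le fun i _ => ?_
    rw [← NNReal.coe_le_coe, NNReal.coe_sum]
    simp only [coe_nnnorm]
    exact hrow i
  exact_mod_cast h

end Summit.Ventures.LatticeQCDFlow.Exactness
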